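import Mathlib.Analysis.SpecialFunctions.Sqrt
import Mathlib.Analysis.Calculus.Deriv.MeanValue
import Summits.AtomisticToContinuum.HydrodynamicLimit.Theorems.TwoClocksEquilibriumFastWindowLDBirthT12Euler
import HarnessLib

/-!
# The zonal Euler–Volterra equation of the Lorentz limit with a GROWING defect
# (helper `t12_euler_zonal_linLogGrowth` of the line `birth`, crux `TwoClocks.EquilibriumFastWindowLD`,
# stmt-AtomisticToContinuum-14440; bootstrap rounds of item T1, sector `ℓ = 0`, of the registered
# sub-goal `t12_logLinearPreimage_and_dipoleModulus`)

File `…BirthT12Euler` solves the `ℓ = 0` Euler–Volterra equation of the far-field linearised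
hard-sphere operator, `f(s) = (4/s²) ∫₀ˢ t f(t) dt - (a s + δ(s))` (`s ≥ s₀`), for a BOUNDED defect
`|δ| ≤ Γ` (`t12_euler_zonal_quadraticPlusLinear`: `f = q s² + 3a s + O(Γ)`). In the bootstrap for the
zonal profile of the corrector the defect is NOT bounded in the first rounds: the comparison error of
a quadratic-log profile divided by the collision frequency `ν ≍ s` is of size
`Γ (1+s)(1 + log(1+s))` (round 1), then `Γ (1 + log(1+s))` (round 2), and only then bounded. This file
proves the rounds with growing defects, by the same Euler-quotient argument
(`(F/s⁴ - a/s)' = -δ/s³`, `F = ∫₀ t f`, `hasDerivAt_euler_zonal`) now with CONVERGENT WEIGHTED TAILS: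

* `euler_zonal_weighted` — (EG0, abstract weight) if `|δ| ≤ Γ w` and
  `∫ₛ^∞ w(t) dt/t³ ≤ K w(s)/s²` (`s ≥ s₀`), then `|f(s) - q s² - 3a s| ≤ (4K+1) Γ w(s)` and
  `|q - 4(F(s₀)/s₀⁴ - a/s₀)| ≤ 4KΓ w(s₀)/s₀²` (`w ≡ 1`, `K = 1/2` is the bounded round);
* `antitoneOn_one_add_log_div_sqrt`, `logWeight_tail`, `logWeight_cubicTail`,
  `linLogWeight_cubicTail` — the log weight `1 + log(1+t)` varies slower than `√t`
  (`(1 + log(1+t))/√t` is antitone on `(0, ∞)`), hence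
  `∫ₛ^∞ (1 + log(1+t)) dt/tⁿ ≤ (1 + log(1+s))/((n - 3/2) sⁿ⁻¹)` (`n ≥ 2`) and the cubic tails of
  `1 + log(1+t)` (`K = 1`) and `(1+t)(1 + log(1+t))` (`K = 2`);
* `powWeight_cubicTail`, `euler_zonal_powGrowth` — (EG0-pow) `|δ| ≤ Γ(1+s)^p`, `0 ≤ p < 2` ⟹
  `|f(s) - q s² - 3a s| ≤ (4/(2-p) + 1) Γ (1+s)^p`;
* `euler_zonal_logGrowth` (EG0-log, round 2): `|δ| ≤ Γ(1 + log(1+s))` ⟹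
  **`|f(s) - q s² - 3a s| ≤ 5Γ (1 + log(1+s))`**;
* the **registered helper `t12_euler_zonal_linLogGrowth`** (EG0-linlog, round 1):
  `|δ| ≤ Γ(1+s)(1 + log(1+s))` ⟹ **`|f(s) - q s² - 3a s| ≤ 9Γ (1+s)(1 + log(1+s))`**.

The dipole (`ℓ = 1`) rounds are in the sibling file `…BirthT12EulerGrowthB`. Hypotheses as in
`…BirthT12Euler` (`f` continuous on `(0, ∞)`, `t f(t)` integrable on `[0, s₀]`, the identity on
`[s₀, ∞)`, `s₀ > 0`; `δ` need not be measurable). Pure real analysis, [folklore].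
-/

noncomputable section

open MeasureTheory Real Set Filter intervalIntegral
open scoped ENNReal BigOperators Topology

namespace Summit.AtomisticToContinuum.HydrodynamicLimit.Theorems.ClampedCorrectorBirth

/-! ### `ℓ = 0`: the zonal sector with a weighted defect -/

/-- **(EG0, abstract weight) The zonal Euler–Volterra equation with a growing defect.** Let `f` be
continuous on `(0, ∞)` with `t f(t)` integrable on `[0, s₀]`, and suppose
`f(s) = (4/s²) ∫₀ˢ t f(t) dt - (a s + δ(s))` for `s ≥ s₀ > 0` with `|δ(s)| ≤ Γ w(s)`, where the weight
`w` has CONVERGENT CUBIC TAILS: `∫_{(s,∞)} w(t) dt/t³ ≤ K w(s)/s²` for `s ≥ s₀`. Then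
**`|f(s) - q s² - 3a s| ≤ (4K+1) Γ w(s)`** for `s ≥ s₀`, with the leading coefficient
`q = 4(F(s₀)/s₀⁴ - a/s₀ - ∫_{s₀}^∞ δ/t³)`, `F(s₀) = ∫₀^{s₀} t f`, pinned by
`|q - 4(F(s₀)/s₀⁴ - a/s₀)| ≤ 4KΓ w(s₀)/s₀²`. Proof: `(F/s⁴ - a/s)' = -δ/s³` (`hasDerivAt_euler_zonal`),
so `f - q s² - 3a s = 4s² ∫ₛ^∞ δ/t³ - δ` (`w ≡ 1`, `K = 1/2`: `t12_euler_zonal_quadraticPlusLinear`). [folklore] -/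
theorem euler_zonal_weighted {f δ w : ℝ → ℝ} {a Γ K s₀ : ℝ} (hs₀ : 0 < s₀) (hΓ : 0 ≤ Γ)
    (hf : ContinuousOn f (Ioi 0)) (hint : IntervalIntegrable (fun t => t * f t) volume 0 s₀)
    (hδ : ∀ s, s₀ ≤ s → |δ s| ≤ Γ * w s)
    (hwi : ∀ s, s₀ ≤ s → IntegrableOn (fun t => w t / t ^ 3) (Ioi s))
    (hwK : ∀ s, s₀ ≤ s → ∫ t in Ioi s, w t / t ^ 3 ≤ K * w s / s ^ 2)
    (hE : ∀ s, s₀ ≤ s → f s = 4 / s ^ 2 * (∫ t in (0:ℝ)..s, t * f t) - (a * s + δ s)) :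
    ∃ q : ℝ, |q - 4 * ((∫ t in (0:ℝ)..s₀, t * f t) / s₀ ^ 4 - a / s₀)| ≤ 4 * K * Γ * w s₀ / s₀ ^ 2 ∧
      ∀ s, s₀ ≤ s → |f s - q * s ^ 2 - 3 * a * s| ≤ (4 * K + 1) * Γ * w s := by
  set F : ℝ → ℝ := fun u => ∫ t in (0:ℝ)..u, t * f t with hF
  set δ' : ℝ → ℝ := fun u => 4 / u ^ 2 * F u - f u - a * u with hδ'
  have hδδ : ∀ u, s₀ ≤ u → δ' u = δ u := fun u hu => by
    simp only [hδ', hF, hE u hu]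
    ring
  have hδ'c : ∀ u, s₀ ≤ u → ContinuousAt (fun u => δ' u / u ^ 3) u := fun u hu => by
    have hu0 : 0 < u := hs₀.trans_le hu
    have h1 : ContinuousAt (fun u : ℝ => 4 / u ^ 2) u :=
      continuousAt_const.div (continuousAt_pow _ _) (pow_ne_zero 2 hu0.ne')
    have h2 : ContinuousAt F u := (hasDerivAt_firstMoment hs₀ hu hf hint).continuousAt
    have h3 : ContinuousAt f u := hf.continuousAt (Ioi_mem_nhds hu0)
    have h4 : ContinuousAt (fun u : ℝ => a * u) u := (continuous_const.mul continuous_id).continuousAt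
    exact (((h1.mul h2).sub h3).sub h4).div (continuousAt_pow _ _) (pow_ne_zero 3 hu0.ne')
  have hδ'co : ContinuousOn (fun u => δ' u / u ^ 3) (Ici s₀) := fun u hu =>
    (hδ'c u hu).continuousWithinAt
  have hbound : ∀ s, s₀ ≤ s →
      ∀ᵐ u ∂(volume.restrict (Ioi s)), ‖δ' u / u ^ 3‖ ≤ Γ * (w u / u ^ 3) := by
    intro s hs
    filter_upwards [ae_restrict_mem measurableSet_Ioi] with u hu
    have hu₀ : s₀ ≤ u := hs.trans (le_of_lt hu)
    have hu0 : 0 < u := hs₀.trans_le hu₀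
    rw [Real.norm_eq_abs, abs_div, abs_of_pos (pow_pos hu0 3), hδδ u hu₀, ← mul_div_assoc]
    exact div_le_div_of_nonneg_right (hδ u hu₀) (pow_pos hu0 3).le
  have htail_int : ∀ s, s₀ ≤ s → IntegrableOn (fun u => δ' u / u ^ 3) (Ioi s) := fun s hs =>
    ((hwi s hs).const_mul Γ).mono'
      ((hδ'co.mono fun u hu => hs.trans (le_of_lt hu)).aestronglyMeasurable measurableSet_Ioi)
      (hbound s hs)
  have htail : ∀ s, s₀ ≤ s → |∫ u in Ioi s, δ' u / u ^ 3| ≤ Γ * (K * w s / s ^ 2) := by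
    intro s hs
    have h := norm_integral_le_of_norm_le ((hwi s hs).const_mul Γ) (hbound s hs)
    rw [Real.norm_eq_abs, MeasureTheory.integral_const_mul] at h
    exact h.trans (mul_le_mul_of_nonneg_left (hwK s hs) hΓ)
  have hW : ∀ s, s₀ ≤ s →
      F s / s ^ 4 - a / s - (F s₀ / s₀ ^ 4 - a / s₀) = -∫ u in s₀..s, δ' u / u ^ 3 := by
    intro s hs
    have hd : ∀ u ∈ uIcc s₀ s, HasDerivAt (fun u => F u / u ^ 4 - a / u) (-(δ' u / u ^ 3)) u := by
      intro u hu
      rw [uIcc_of_le hs] at hu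
      exact hasDerivAt_euler_zonal a hs₀ hu.1 hf hint
    have hi : IntervalIntegrable (fun u => -(δ' u / u ^ 3)) volume s₀ s := by
      refine (ContinuousOn.intervalIntegrable ?_).neg
      rw [uIcc_of_le hs]
      exact hδ'co.mono Icc_subset_Ici_self
    rw [← intervalIntegral.integral_neg, integral_eq_sub_of_hasDerivAt hd hi]
  set I : ℝ := ∫ u in Ioi s₀, δ' u / u ^ 3 with hI
  refine ⟨4 * (F s₀ / s₀ ^ 4 - a / s₀ - I), ?_, fun s hs => ?_⟩
  · have h := htail s₀ le_rfl
    rw [show 4 * (F s₀ / s₀ ^ 4 - a / s₀ - I) - 4 * (F s₀ / s₀ ^ 4 - a / s₀) = -4 * I by ring,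
      abs_mul, abs_neg, show |(4:ℝ)| = 4 by norm_num]
    calc 4 * |I| ≤ 4 * (Γ * (K * w s₀ / s₀ ^ 2)) := by gcongr
      _ = 4 * K * Γ * w s₀ / s₀ ^ 2 := by ring
  · have hs' : 0 < s := hs₀.trans_le hs
    have hsplit : I - ∫ u in Ioi s, δ' u / u ^ 3 = ∫ u in s₀..s, δ' u / u ^ 3 :=
      integral_Ioi_sub_Ioi (htail_int s₀ le_rfl) hs
    set J : ℝ := ∫ u in Ioi s, δ' u / u ^ 3 with hJ
    have hFs : F s = (a / s + (F s₀ / s₀ ^ 4 - a / s₀) - (I - J)) * s ^ 4 := by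
      rw [← div_eq_iff (pow_ne_zero 4 hs'.ne')]
      linarith [hW s hs]
    have key : f s - 4 * (F s₀ / s₀ ^ 4 - a / s₀ - I) * s ^ 2 - 3 * a * s = 4 * s ^ 2 * J - δ s := by
      rw [hE s hs]
      change 4 / s ^ 2 * F s - (a * s + δ s) - 4 * (F s₀ / s₀ ^ 4 - a / s₀ - I) * s ^ 2 - 3 * a * s
        = 4 * s ^ 2 * J - δ s
      rw [hFs]
      have hs0 : s ≠ 0 := hs'.ne'
      field_simp
      ring
    rw [key]
    calc |4 * s ^ 2 * J - δ s| ≤ |4 * s ^ 2 * J| + |δ s| := abs_sub _ _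
      _ = 4 * s ^ 2 * |J| + |δ s| := by rw [abs_mul, abs_of_pos (by positivity)]
      _ ≤ 4 * s ^ 2 * (Γ * (K * w s / s ^ 2)) + Γ * w s := by
          gcongr
          · exact htail s hs
          · exact hδ s hs
      _ = (4 * K + 1) * Γ * w s := by
          have hs0 : s ^ 2 ≠ 0 := pow_ne_zero 2 hs'.ne'
          field_simp

/-! ### The log weight `1 + log (1 + t)`: slow variation and cubic/quadratic tails -/

/-- The log weight `m(t) = 1 + log(1+t)` grows slower than `√t`: **`t ↦ m(t)/√t` is antitone on
`(0, ∞)`** — its derivative has the sign of `2t - (1+t) m(t) ≤ 2t - (1+t)(2 - 1/(1+t)) = -1 < 0`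
by `log(1+t) ≥ 1 - 1/(1+t)`. [folklore] -/
theorem antitoneOn_one_add_log_div_sqrt :
    AntitoneOn (fun t : ℝ => (1 + Real.log (1 + t)) / Real.sqrt t) (Set.Ioi 0) := by
  have hd : ∀ t : ℝ, 0 < t → HasDerivAt (fun t : ℝ => (1 + Real.log (1 + t)) / Real.sqrt t)
      (((1 + t)⁻¹ * Real.sqrt t - (1 + Real.log (1 + t)) * (1 / (2 * Real.sqrt t)))
        / Real.sqrt t ^ 2) t := by
    intro t ht
    have h1 : HasDerivAt (fun t : ℝ => 1 + Real.log (1 + t)) (1 + t)⁻¹ t := by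
      have h := (((hasDerivAt_id' t).const_add 1).log (by positivity : (1:ℝ) + t ≠ 0)).const_add 1
      simpa only [one_div] using h
    exact h1.div (Real.hasDerivAt_sqrt ht.ne') (Real.sqrt_pos.2 ht).ne'
  refine antitoneOn_of_hasDerivWithinAt_nonpos (convex_Ioi 0)
    (f' := fun t => ((1 + t)⁻¹ * Real.sqrt t - (1 + Real.log (1 + t)) * (1 / (2 * Real.sqrt t)))
        / Real.sqrt t ^ 2)
    (fun t ht => (hd t ht).continuousAt.continuousWithinAt) ?_ ?_
  · rw [interior_Ioi]
    exact fun t ht => (hd t ht).hasDerivWithinAt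
  · rw [interior_Ioi]
    intro t ht
    have ht' : (0:ℝ) < t := ht
    have h1t : (0:ℝ) < 1 + t := by positivity
    have hlog : 1 - (1 + t)⁻¹ ≤ Real.log (1 + t) := Real.one_sub_inv_le_log_of_pos h1t
    refine div_nonpos_of_nonpos_of_nonneg ?_ (sq_nonneg _)
    rw [sub_nonpos, mul_one_div, le_div_iff₀ (by positivity)]
    have hkey : (1 + t)⁻¹ * Real.sqrt t * (2 * Real.sqrt t) = 2 * (1 - (1 + t)⁻¹) := by
      have : Real.sqrt t * Real.sqrt t = t := Real.mul_self_sqrt ht'.le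
      field_simp
      nlinarith [this]
    rw [hkey]
    nlinarith [hlog, inv_nonneg.2 h1t.le]

/-- Pointwise form of `antitoneOn_one_add_log_div_sqrt` in the half-power notation:
`(1 + log(1+t)) t^{-1/2} ≤ (1 + log(1+s)) s^{-1/2}` for `0 < s ≤ t`. [folklore] -/
theorem one_add_log_mul_rpow_neg_half_le {s t : ℝ} (hs : 0 < s) (hst : s ≤ t) :
    (1 + Real.log (1 + t)) * t ^ (-(1 / 2 : ℝ)) ≤ (1 + Real.log (1 + s)) * s ^ (-(1 / 2 : ℝ)) := by
  have ht : 0 < t := hs.trans_le hst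
  have h := antitoneOn_one_add_log_div_sqrt hs ht hst
  rw [Real.rpow_neg ht.le, Real.rpow_neg hs.le, ← Real.sqrt_eq_rpow, ← Real.sqrt_eq_rpow]
  simpa only [div_eq_mul_inv] using h

/-- The log weights are at least `1` on `[0, ∞)`: `1 ≤ 1 + log(1+s)` for `0 ≤ s`. [folklore] -/
theorem one_le_one_add_log_one_add {s : ℝ} (hs : 0 ≤ s) : 1 ≤ 1 + Real.log (1 + s) := by
  linarith [Real.log_nonneg (by linarith : (1:ℝ) ≤ 1 + s)]

/-- **Cubic and quadratic tails of the log weight.** For `s > 0` and an integer `n ≥ 2`,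
`t ↦ (1 + log(1+t))/tⁿ` is integrable on `(s, ∞)` and
`∫_{(s,∞)} (1 + log(1+t)) dt/tⁿ ≤ (1 + log(1+s)) / ((n - 3/2) s^{n-1})`: dominate by
`(1 + log(1+s)) s^{-1/2} · t^{1/2-n}` (`one_add_log_mul_rpow_neg_half_le`) and integrate the power
(`integral_Ioi_rpow_of_lt`). [folklore] -/
theorem logWeight_tail {s : ℝ} (hs : 0 < s) {n : ℕ} (hn : 2 ≤ n) :
    IntegrableOn (fun t : ℝ => (1 + Real.log (1 + t)) / t ^ n) (Set.Ioi s) ∧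
      ∫ t in Set.Ioi s, (1 + Real.log (1 + t)) / t ^ n ≤
        (1 + Real.log (1 + s)) / (((n : ℝ) - 3 / 2) * s ^ (n - 1)) := by
  set a : ℝ := 1 / 2 - n with ha
  have hn' : (2:ℝ) ≤ n := by exact_mod_cast hn
  have ha1 : a < -1 := by rw [ha]; linarith
  set C : ℝ := (1 + Real.log (1 + s)) * s ^ (-(1 / 2 : ℝ)) with hC
  have hm0 : ∀ t : ℝ, 0 < t → 0 < 1 + Real.log (1 + t) := fun t ht =>
    one_pos.trans_le (one_le_one_add_log_one_add ht.le)
  have hpt : ∀ t ∈ Ioi s, (1 + Real.log (1 + t)) / t ^ n ≤ C * t ^ a := by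
    intro t ht
    have ht0 : 0 < t := hs.trans ht
    have hsplit : (1 + Real.log (1 + t)) / t ^ n =
        (1 + Real.log (1 + t)) * t ^ (-(1 / 2 : ℝ)) * t ^ a := by
      rw [mul_assoc, ← Real.rpow_add ht0, ha, show -(1 / 2 : ℝ) + (1 / 2 - n) = -(n : ℝ) by ring,
        Real.rpow_neg ht0.le, Real.rpow_natCast, div_eq_mul_inv]
    rw [hsplit]
    exact mul_le_mul_of_nonneg_right (one_add_log_mul_rpow_neg_half_le hs ht.le)
      (Real.rpow_nonneg ht0.le _)
  have hnn : ∀ t ∈ Ioi s, 0 ≤ (1 + Real.log (1 + t)) / t ^ n := fun t ht =>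
    div_nonneg (hm0 t (hs.trans ht)).le (pow_nonneg (hs.trans ht).le n)
  have hcont : ContinuousOn (fun t : ℝ => (1 + Real.log (1 + t)) / t ^ n) (Ioi s) := by
    intro t ht
    have ht0 : 0 < t := hs.trans ht
    have h1 : ContinuousAt (fun t : ℝ => 1 + Real.log (1 + t)) t :=
      continuousAt_const.add ((continuousAt_const.add continuousAt_id).log
        (by simpa using (by positivity : (1:ℝ) + t ≠ 0)))
    exact (h1.div (continuousAt_pow _ _) (pow_ne_zero n ht0.ne')).continuousWithinAt
  have hgi : IntegrableOn (fun t : ℝ => C * t ^ a) (Ioi s) :=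
    (integrableOn_Ioi_rpow_of_lt ha1 hs).const_mul C
  have hfi : IntegrableOn (fun t : ℝ => (1 + Real.log (1 + t)) / t ^ n) (Ioi s) := by
    refine hgi.mono' (hcont.aestronglyMeasurable measurableSet_Ioi) ?_
    filter_upwards [ae_restrict_mem measurableSet_Ioi] with t ht
    rw [Real.norm_of_nonneg (hnn t ht)]
    exact hpt t ht
  refine ⟨hfi, ?_⟩
  have hs1 : s ^ (-(1 / 2 : ℝ)) * s ^ (a + 1) = (s ^ (n - 1))⁻¹ := by
    rw [← Real.rpow_add hs, ha, show -(1 / 2 : ℝ) + (1 / 2 - n + 1) = -((n : ℝ) - 1) by ring,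
      Real.rpow_neg hs.le, show (n : ℝ) - 1 = ((n - 1 : ℕ) : ℝ) by
        rw [Nat.cast_sub (by omega), Nat.cast_one], Real.rpow_natCast]
  have ha2 : a + 1 = -((n : ℝ) - 3 / 2) := by rw [ha]; ring
  have hne : (n : ℝ) - 3 / 2 ≠ 0 := by linarith
  calc ∫ t in Ioi s, (1 + Real.log (1 + t)) / t ^ n ≤ ∫ t in Ioi s, C * t ^ a :=
        setIntegral_mono_on hfi hgi measurableSet_Ioi hpt
    _ = C * (-s ^ (a + 1) / (a + 1)) := by
        rw [MeasureTheory.integral_const_mul, integral_Ioi_rpow_of_lt ha1 hs]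
    _ = (1 + Real.log (1 + s)) * (s ^ (-(1 / 2 : ℝ)) * s ^ (a + 1)) * (-1 / (a + 1)) := by
        rw [hC]
        ring
    _ = (1 + Real.log (1 + s)) / (((n : ℝ) - 3 / 2) * s ^ (n - 1)) := by
        rw [hs1, ha2]
        field_simp

/-- **Cubic tail of the log weight** `w(t) = 1 + log(1+t)` in the form consumed by
`euler_zonal_weighted`: `∫_{(s,∞)} w(t) dt/t³ ≤ 1 · w(s)/s²` (`s > 0`; the sharp constant of
`logWeight_tail` is `2/3`). [folklore] -/
theorem logWeight_cubicTail {s : ℝ} (hs : 0 < s) :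
    IntegrableOn (fun t : ℝ => (1 + Real.log (1 + t)) / t ^ 3) (Set.Ioi s) ∧
      ∫ t in Set.Ioi s, (1 + Real.log (1 + t)) / t ^ 3 ≤ 1 * (1 + Real.log (1 + s)) / s ^ 2 := by
  obtain ⟨hi, hle⟩ := logWeight_tail hs (by norm_num : 2 ≤ 3)
  refine ⟨hi, hle.trans ?_⟩
  have hm0 : 0 ≤ 1 + Real.log (1 + s) := zero_le_one.trans (one_le_one_add_log_one_add hs.le)
  have hs2 : 0 < s ^ 2 := by positivity
  norm_num
  rw [div_le_div_iff₀ (by positivity) hs2]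
  nlinarith

/-- **Cubic tail of the lin-log weight** `w(t) = (1+t)(1 + log(1+t))`:
`∫_{(s,∞)} w(t) dt/t³ ≤ 2 w(s)/s²` for `s > 0` (split `(1+t)/t³ = 1/t³ + 1/t²` and use
`logWeight_tail` with `n = 3, 2`: `2/3 + 2s ≤ 2(1+s)`). [folklore] -/
theorem linLogWeight_cubicTail {s : ℝ} (hs : 0 < s) :
    IntegrableOn (fun t : ℝ => (1 + t) * (1 + Real.log (1 + t)) / t ^ 3) (Set.Ioi s) ∧
      ∫ t in Set.Ioi s, (1 + t) * (1 + Real.log (1 + t)) / t ^ 3 ≤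
        2 * ((1 + s) * (1 + Real.log (1 + s))) / s ^ 2 := by
  obtain ⟨hi3, hle3⟩ := logWeight_tail hs (by norm_num : 2 ≤ 3)
  obtain ⟨hi2, hle2⟩ := logWeight_tail hs (le_refl 2)
  have heq : EqOn (fun t : ℝ => (1 + t) * (1 + Real.log (1 + t)) / t ^ 3)
      (fun t : ℝ => (1 + Real.log (1 + t)) / t ^ 3 + (1 + Real.log (1 + t)) / t ^ 2) (Ioi s) := by
    intro t ht
    have ht0 : (t:ℝ) ≠ 0 := (hs.trans ht).ne'
    simp only
    field_simp
  refine ⟨(hi3.add hi2).congr_fun heq.symm measurableSet_Ioi, ?_⟩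
  rw [setIntegral_congr_fun measurableSet_Ioi heq, integral_add hi3 hi2]
  have hm0 : 0 ≤ 1 + Real.log (1 + s) := zero_le_one.trans (one_le_one_add_log_one_add hs.le)
  refine (add_le_add hle3 hle2).trans ?_
  norm_num
  rw [div_add_div _ _ (by positivity) (by positivity), div_le_div_iff₀ (by positivity) (by positivity)]
  ring_nf
  nlinarith [mul_nonneg hm0 hs.le, mul_nonneg (mul_nonneg hm0 hs.le) hs.le,
    mul_nonneg (mul_nonneg (mul_nonneg hm0 hs.le) hs.le) hs.le]

/-- **Cubic tail of the power weight** `w(t) = (1+t)^p`, `0 ≤ p < 2`: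
`∫_{(s,∞)} (1+t)^p dt/t³ ≤ (1+s)^p/((2-p) s²)` for `s > 0` (dominate by `((1+s)/s)^p t^{p-3}`,
`(1+t)/t` being antitone, and integrate the power). [folklore] -/
theorem powWeight_cubicTail {p s : ℝ} (hp : 0 ≤ p) (hp2 : p < 2) (hs : 0 < s) :
    IntegrableOn (fun t : ℝ => (1 + t) ^ p / t ^ 3) (Set.Ioi s) ∧
      ∫ t in Set.Ioi s, (1 + t) ^ p / t ^ 3 ≤ (2 - p)⁻¹ * (1 + s) ^ p / s ^ 2 := by
  set C : ℝ := ((1 + s) / s) ^ p with hC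
  have ha : p - 3 < -1 := by linarith
  have hpt : ∀ t ∈ Ioi s, (1 + t) ^ p / t ^ 3 ≤ C * t ^ (p - 3) := by
    intro t ht
    have ht0 : 0 < t := hs.trans ht
    have h1 : (1 + t) ^ p / t ^ 3 = ((1 + t) / t) ^ p * t ^ (p - 3) := by
      rw [Real.div_rpow (by positivity) ht0.le, Real.rpow_sub ht0,
        show (t : ℝ) ^ (3 : ℝ) = t ^ (3 : ℕ) from by rw [← Real.rpow_natCast]; norm_num]
      have : t ^ p ≠ 0 := (Real.rpow_pos_of_pos ht0 p).ne'
      field_simp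
    rw [h1]
    refine mul_le_mul_of_nonneg_right (Real.rpow_le_rpow (by positivity) ?_ hp)
      (Real.rpow_nonneg ht0.le _)
    rw [div_le_div_iff₀ ht0 hs]
    nlinarith [(show s < t from ht).le]
  have hcont : ContinuousOn (fun t : ℝ => (1 + t) ^ p / t ^ 3) (Ioi s) := fun t ht => by
    have ht0 : 0 < t := hs.trans ht
    exact (((continuousAt_const.add continuousAt_id).rpow_const
      (Or.inl (by positivity : (1:ℝ) + t ≠ 0))).div (continuousAt_pow _ _)
      (pow_ne_zero 3 ht0.ne')).continuousWithinAt
  have hgi : IntegrableOn (fun t : ℝ => C * t ^ (p - 3)) (Ioi s) :=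
    (integrableOn_Ioi_rpow_of_lt ha hs).const_mul C
  have hfi : IntegrableOn (fun t : ℝ => (1 + t) ^ p / t ^ 3) (Ioi s) := by
    refine hgi.mono' (hcont.aestronglyMeasurable measurableSet_Ioi) ?_
    filter_upwards [ae_restrict_mem measurableSet_Ioi] with t ht
    rw [Real.norm_of_nonneg (div_nonneg (Real.rpow_nonneg (by linarith [hs.trans ht]) _)
      (pow_nonneg (hs.trans ht).le 3))]
    exact hpt t ht
  refine ⟨hfi, ?_⟩
  have hsp : s ^ p ≠ 0 := (Real.rpow_pos_of_pos hs p).ne'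
  have hp2' : p - 2 ≠ 0 := by linarith
  have hp2'' : 2 - p ≠ 0 := by linarith
  calc ∫ t in Ioi s, (1 + t) ^ p / t ^ 3 ≤ ∫ t in Ioi s, C * t ^ (p - 3) :=
        setIntegral_mono_on hfi hgi measurableSet_Ioi hpt
    _ = C * (-s ^ (p - 3 + 1) / (p - 3 + 1)) := by
        rw [MeasureTheory.integral_const_mul, integral_Ioi_rpow_of_lt ha hs]
    _ = (2 - p)⁻¹ * (1 + s) ^ p / s ^ 2 := by
        rw [hC, Real.div_rpow (by positivity) hs.le, show p - 3 + 1 = p - 2 by ring,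
          Real.rpow_sub hs, Real.rpow_two]
        field_simp
        ring

/-- **(EG0-pow) The zonal round with a power defect.** `|δ(s)| ≤ Γ (1+s)^p` with `0 ≤ p < 2`
forces `|f(s) - q s² - 3a s| ≤ (4/(2-p) + 1) Γ (1+s)^p` (`s ≥ s₀`) and
`|q - 4(F(s₀)/s₀⁴ - a/s₀)| ≤ (4/(2-p)) Γ (1+s₀)^p/s₀²` (`euler_zonal_weighted` with
`powWeight_cubicTail`; `p = 0` is the bounded round with constants `3Γ`, `2Γ/s₀²`). [folklore] -/
theorem euler_zonal_powGrowth {f δ : ℝ → ℝ} {a Γ p s₀ : ℝ} (hs₀ : 0 < s₀) (hp : 0 ≤ p)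
    (hp2 : p < 2) (hf : ContinuousOn f (Ioi 0))
    (hint : IntervalIntegrable (fun t => t * f t) volume 0 s₀)
    (hδ : ∀ s, s₀ ≤ s → |δ s| ≤ Γ * (1 + s) ^ p)
    (hE : ∀ s, s₀ ≤ s → f s = 4 / s ^ 2 * (∫ t in (0:ℝ)..s, t * f t) - (a * s + δ s)) :
    ∃ q : ℝ, |q - 4 * ((∫ t in (0:ℝ)..s₀, t * f t) / s₀ ^ 4 - a / s₀)| ≤
        4 * (2 - p)⁻¹ * Γ * (1 + s₀) ^ p / s₀ ^ 2 ∧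
      ∀ s, s₀ ≤ s → |f s - q * s ^ 2 - 3 * a * s| ≤ (4 * (2 - p)⁻¹ + 1) * Γ * (1 + s) ^ p :=
  have hΓ : 0 ≤ Γ := nonneg_of_mul_nonneg_left ((abs_nonneg _).trans (hδ s₀ le_rfl))
    (Real.rpow_pos_of_pos (by linarith) _)
  euler_zonal_weighted (w := fun s => (1 + s) ^ p) (K := (2 - p)⁻¹) hs₀ hΓ hf hint hδ
    (fun s hs => (powWeight_cubicTail hp hp2 (hs₀.trans_le hs)).1)
    (fun s hs => (powWeight_cubicTail hp hp2 (hs₀.trans_le hs)).2) hE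

/-- **(EG0-log) The second bootstrap round of T1 in the sector `ℓ = 0`.** The zonal Euler–Volterra
equation of the Lorentz limit, `f(s) = (4/s²) ∫₀ˢ t f(t) dt - (a s + δ(s))` for `s ≥ s₀ > 0`, with a
LOGARITHMICALLY GROWING defect `|δ(s)| ≤ Γ (1 + log(1+s))`, forces
**`|f(s) - q s² - 3a s| ≤ 5Γ (1 + log(1+s))`** for `s ≥ s₀`, with
`q = 4(F(s₀)/s₀⁴ - a/s₀ - ∫_{s₀}^∞ δ/t³)`, `F(s₀) = ∫₀^{s₀} t f`,
`|q - 4(F(s₀)/s₀⁴ - a/s₀)| ≤ 4Γ (1 + log(1+s₀))/s₀²` (`euler_zonal_weighted` with the cubic tail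
`∫ₛ^∞ (1 + log(1+t)) dt/t³ ≤ (1 + log(1+s))/s²`, `K = 1`). [folklore] -/
theorem euler_zonal_logGrowth {f δ : ℝ → ℝ} {a Γ s₀ : ℝ} (hs₀ : 0 < s₀)
    (hf : ContinuousOn f (Ioi 0)) (hint : IntervalIntegrable (fun t => t * f t) volume 0 s₀)
    (hδ : ∀ s, s₀ ≤ s → |δ s| ≤ Γ * (1 + Real.log (1 + s)))
    (hE : ∀ s, s₀ ≤ s → f s = 4 / s ^ 2 * (∫ t in (0:ℝ)..s, t * f t) - (a * s + δ s)) :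
    ∃ q : ℝ, |q - 4 * ((∫ t in (0:ℝ)..s₀, t * f t) / s₀ ^ 4 - a / s₀)| ≤
        4 * Γ * (1 + Real.log (1 + s₀)) / s₀ ^ 2 ∧
      ∀ s, s₀ ≤ s → |f s - q * s ^ 2 - 3 * a * s| ≤ 5 * Γ * (1 + Real.log (1 + s)) := by
  have hΓ : 0 ≤ Γ := nonneg_of_mul_nonneg_left ((abs_nonneg _).trans (hδ s₀ le_rfl))
    (lt_of_lt_of_le one_pos (one_le_one_add_log_one_add hs₀.le))
  obtain ⟨q, hq, hrem⟩ := euler_zonal_weighted (w := fun s => 1 + Real.log (1 + s)) (K := 1) hs₀ hΓ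
    hf hint hδ (fun s hs => (logWeight_cubicTail (hs₀.trans_le hs)).1)
    (fun s hs => (logWeight_cubicTail (hs₀.trans_le hs)).2) hE
  exact ⟨q, by simpa using hq, fun s hs => by have := hrem s hs; norm_num at this; exact this⟩

/-- **Registered helper `t12_euler_zonal_linLogGrowth` (EG0-linlog: the first bootstrap round of T1
in the sector `ℓ = 0`).** The zonal Euler–Volterra equation of the Lorentz limit,
`f(s) = (4/s²) ∫₀ˢ t f(t) dt - (a s + δ(s))` for `s ≥ s₀ > 0`, with a LIN-LOG defect
`|δ(s)| ≤ Γ (1+s)(1 + log(1+s))` (the comparison error of a quadratic-log profile divided by the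
collision frequency `ν ≍ s`), forces **`|f(s) - q s² - 3a s| ≤ 9Γ (1+s)(1 + log(1+s))`** for
`s ≥ s₀`, with `q = 4(F(s₀)/s₀⁴ - a/s₀ - ∫_{s₀}^∞ δ/t³)`, `F(s₀) = ∫₀^{s₀} t f`,
`|q - 4(F(s₀)/s₀⁴ - a/s₀)| ≤ 8Γ (1+s₀)(1 + log(1+s₀))/s₀²` (`euler_zonal_weighted` with the cubic
tail `∫ₛ^∞ (1+t)(1 + log(1+t)) dt/t³ ≤ 2(1+s)(1 + log(1+s))/s²`, `K = 2`). [folklore] -/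
theorem t12_euler_zonal_linLogGrowth : ∀ (f δ : ℝ → ℝ) (a Γ s₀ : ℝ), 0 < s₀ → ContinuousOn f (Set.Ioi 0) → IntervalIntegrable (fun t => t * f t) MeasureTheory.volume 0 s₀ → (∀ s, s₀ ≤ s → |δ s| ≤ Γ * ((1 + s) * (1 + Real.log (1 + s)))) → (∀ s, s₀ ≤ s → f s = 4 / s ^ 2 * (∫ t in (0:ℝ)..s, t * f t) - (a * s + δ s)) → ∃ q : ℝ, |q - 4 * ((∫ t in (0:ℝ)..s₀, t * f t) / s₀ ^ 4 - a / s₀)| ≤ 8 * Γ * ((1 + s₀) * (1 + Real.log (1 + s₀))) / s₀ ^ 2 ∧ ∀ s, s₀ ≤ s → |f s - q * s ^ 2 - 3 * a * s| ≤ 9 * Γ * ((1 + s) * (1 + Real.log (1 + s))) := by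
  intro f δ a Γ s₀ hs₀ hf hint hδ hE
  have hw0 : 0 < (1 + s₀) * (1 + Real.log (1 + s₀)) :=
    mul_pos (by linarith) (lt_of_lt_of_le one_pos (one_le_one_add_log_one_add hs₀.le))
  have hΓ : 0 ≤ Γ := nonneg_of_mul_nonneg_left ((abs_nonneg _).trans (hδ s₀ le_rfl)) hw0
  obtain ⟨q, hq, hrem⟩ := euler_zonal_weighted (w := fun s => (1 + s) * (1 + Real.log (1 + s)))
    (K := 2) hs₀ hΓ hf hint hδ
    (fun s hs => by simpa only [mul_div_assoc] using (linLogWeight_cubicTail (hs₀.trans_le hs)).1)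
    (fun s hs => by simpa only [mul_div_assoc] using (linLogWeight_cubicTail (hs₀.trans_le hs)).2) hE
  exact ⟨q, by convert hq using 1; ring, fun s hs => by have := hrem s hs; norm_num at this; exact this⟩

end Summit.AtomisticToContinuum.HydrodynamicLimit.Theorems.ClampedCorrectorBirth

end
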